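import Summits.BirchSwinnertonDyer.BirchSwinnertonDyer.Theses.KatoDescentPotSupersingular
import Summits.BirchSwinnertonDyer.Rank1Residual.Additive.X4RankZeroKatoBoundTamagawaExact
import Summits.BirchSwinnertonDyer.BirchSwinnertonDyer.Theorems.KatoDescentPotSupersingularMuCoreIrrConjAThree
import Summits.BirchSwinnertonDyer.BirchSwinnertonDyer.Theorems.AdditiveWildRankOneNonTowerOfConjA
import Literature.NumberTheory.EllipticCurves.Kato2004.EulerSystemClassNonvanishingProofs
import Literature.NumberTheory.EllipticCurves.CuspFormLFunctionAnalyticRankProofs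
import HarnessLib

/-!
# Route `KatoDescentPotSupersingular` (rung K9, cell `bsd-potss`): the U₀-ns node `WildUpperNonsurjTower` (item 19189) and the
# U₀ parent `WildUpperDefectRankZero` (item 19197) BY NAME on the FINE road — from Kato's fine-Selmer reading (held input
# `PublishedInputKatoA161FineSelmer` 19422), Gross–Zagier–Kolyvagin (19273), the zeta-body inputs (held 24326) and ONE
# conjecture-grade statement «Kato's zeta class is a Λ-multiple of a 3-indivisible Euler-system class» on ALL U₀-ns rows —
# CONDITIONAL alternative keying (items stay open; the planner decides)

Seat `bsd-potss-k9-c4` g15 (prover; cell `bsd-potss`); `--supports stmt-BirchSwinnertonDyer-19197 --as helper`; closes nothing.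
HONEST FRAMING: BSD is not proved by any of this; nothing is booked; Conjecture A / `μ = 0` are NOT proved.  This is k9-c4 g14's
«NEXT (2)» in the form available today: the U₀-ns node does not need rkm's level-0 count on the fine road, because Kato's fine reading
A161-fine (`Kato2004.rankZero_padicValNat_sha_add_padicValNat_tamagawa_le_of_additive_potGood_of_irreducible_of_fineSelmerDual_fg`,
a HELD published input of this route, item 19422) already carries the descent; its hypothesis (A) at `(W, 3)` is supplied on EVERY
`E[3]`-irreducible row by g14's UNCONDITIONAL `μ`-core (`MuCoreIrr.exists_fineSelmerDualData_moduleFinite_three_of_irr_of_eulerClass`)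
from ONE `3`-indivisible genuine Euler-system class, which the g15 zeta-line statement (kit v2, Λ-MULTIPLE form, here with the row
binders of 19189 instead of 19942's) produces from Kato's zeta body (`HeldKatoZetaBodyInputs` = modularity ∧
`exists_eulerSystem_expStar_values`).  READING for the planner: keyed this way the U₀-ns node's inputs are
{19422, 19273, 24326, «zeta multiple» on all U₀-ns rows} — no Heegner facts (23034–23037), no `PublishedInputsHeegner`, no Cassels /
CM inputs, and the residual `WildRankOne` no longer feeds U₀ — at the price of the conjecture-grade statement on all 344 K9 U₀-ns
rows instead of the 6 residue rows of 19942.  Both keyings are by name in the tree; nothing here asks for a route edit.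

References: [Kato2004Asterisque] Thm. 12.4 (3), 12.5, 13.4, 14.5 (3), Prop. 14.16 (2); [CoatesSujatha2005] Conj. A; [Lim2017FineSelmer]
§3; [BreuilConradDiamondTaylor2001] Thm. A; [Darmon2004] Thm. 3.22.
-/

-- the summit and its single problem are both named `BirchSwinnertonDyer` (registry layout D-0017)
set_option linter.dupNamespace false
set_option autoImplicit false

noncomputable section

open Field WeierstrassCurve
open Literature.NumberTheory.GaloisRepresentations Literature.NumberTheory.EllipticCurves
open Literature.NumberTheory.EllipticCurves.ModularForms Literature.NumberTheory.EllipticCurves.Rank1Residual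
open Literature.NumberTheory.EllipticCurves.Kato2004 Literature.NumberTheory.EllipticCurves.Kato2004.EulerSystemValues
open Summit.BirchSwinnertonDyer.Rank1Residual.Additive

namespace Summit.BirchSwinnertonDyer.BirchSwinnertonDyer.Theorems.WildUpperFineRoadKatoZeta

/-- Modularity in the form `exists_isNewformOf` gives the entire continuation of `L(W, s)` for every `W`
(`IsNewformOf.hasEntireLFunction`), i.e. the named fact `hasEntireLFunction_rat`. [cite: DiamondShurman2005, Thm. 5.10.2 and §8.8] -/
theorem hasEntireLFunction_rat_of_exists_isNewformOf (hmod : exists_isNewformOf) : hasEntireLFunction_rat := by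
  intro W _
  haveI : NeZero (W.conductorNorm ℤ) := ⟨W.conductorNorm_pos_holds.ne'⟩
  obtain ⟨f, hf⟩ := hmod W
  exact hf.hasEntireLFunction

/-- **The U₀-ns node on the FINE road.**  `WildUpperNonsurjTower` (item 19189) from: Kato's fine reading A161-fine (hypothesis
(A) displayed; held input 19422), Gross–Zagier–Kolyvagin (19273), the zeta-body inputs (modularity ∧
`exists_eulerSystem_expStar_values`, held 24326) and the Λ-MULTIPLE zeta statement on all U₀-ns rows (binders of 19189, then the
block of the kit-v2 child).  Per row: the zeta statement and the zeta body give a `3`-indivisible genuine Euler-system class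
(as in `wildCoatesSujathaResidue_of_katoZetaMultiple`), g14's `μ`-core gives (A) at `(W,3)`, and the route-free reading
`UniversalToricDescentWaldspurgerFlat.missingUpperBoundAt_rankZero_of_irreducible_of_fineSelmerDual_fg` gives the upper half
(`Addv`, `ord₃ j ≥ 0` from `ClassO6`).  CONDITIONAL; the item is not closed by this theorem.
[cite: Kato2004Asterisque, Thm. 14.5 (3) (p. 236), Prop. 14.16 (2) (p. 244), Ex. 13.3 (p. 225), Thm. 12.5 (1) (pp. 221–222)]
[cite: CoatesSujatha2005, Conjecture A] [cite: Lim2017FineSelmer, §3] [cite: Darmon2004, Thm. 3.22] -/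
theorem wildUpperNonsurjTower_of_fineReading_of_katoZetaMultiple
    (hKatoA : rankZero_padicValNat_sha_add_padicValNat_tamagawa_le_of_additive_potGood_of_irreducible_of_fineSelmerDual_fg)
    (hGZK : rank_eq_analyticRank_of_analyticRank_le_one)
    (hIn : (exists_isNewformOf : Prop) ∧ (exists_eulerSystem_expStar_values : Prop))
    (hZns : ∀ (W : WeierstrassCurve ℚ) [W.IsElliptic] [W.IsGloballyMinimal] [Fact (3 : ℕ).Prime], W.analyticRank = 0 → Summit.BirchSwinnertonDyer.Rank1Residual.Additive.ClassO6 W 3 → W.HasIrreducibleModPGaloisRep 3 → ¬ (∀ n : ℕ, W.HasSurjectiveModNGaloisRep (3 ^ n : ℕ)) → ∀ (h32 : (3 : ℕ) ≠ 2) (κ : Literature.NumberTheory.EllipticCurves.ZpExtension ℚ 3) (hκ : κ.IsCyclotomic) [ContinuousSMul ℤ_[3] (W.tateModule 3)] [Module.Free ℤ_[3] (W.tateModule 3)] [Module.Finite ℤ_[3] (W.tateModule 3)] (γ : Field.absoluteGaloisGroup ℚ) (I : Literature.NumberTheory.EllipticCurves.Kato2004.IwasawaH1Data W 3 κ γ),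 κ.IsTopGenerator γ → ∀ {N : ℕ} [NeZero N] (f : CuspForm (CongruenceSubgroup.Gamma0 N) 2), Literature.NumberTheory.EllipticCurves.ModularForms.IsNewformOf W f → ∀ (ι : (m : ℕ) → (CyclotomicField m ℚ →+* ℂ)) (κ' : ℝ) (Λ' : ∀ (k : ℕ) (r : Finset (IsDedekindDomain.HeightOneSpectrum (NumberField.RingOfIntegers ℚ))), Literature.NumberTheory.GaloisRepresentations.H1 (Literature.NumberTheory.EllipticCurves.Kato2004.EulerSystemValues.tateRep W 3) (Literature.NumberTheory.EllipticCurves.Kato2004.EulerSystemValues.cycSubgroup 3 k r) →ₗ[ℤ_[3]] TensorProduct ℚ ℚ_[3] (CyclotomicField (Literature.NumberTheory.EllipticCurves.Kato2004.EulerSystemValues.cycLevel 3 k r) ℚ)) (c d a : ℤ) (A : ℕ), 0 < A → Int.gcd c (6 * 3 * A) = 1 → Int.gcd d (6 * 3 * N) = 1 → ∀ (z : ∀ (k : ℕ) (r : (Literature.NumberTheory.GaloisRepresentations.cyclotomicLevelsRat 3 (Literature.NumberTheory.EllipticCurves.Kato2004.EulerSystemValues.badPlaces c d A N)).Ideals),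 Literature.NumberTheory.GaloisRepresentations.H1 (Literature.NumberTheory.EllipticCurves.Kato2004.EulerSystemValues.tateRep W 3) ((Literature.NumberTheory.GaloisRepresentations.cyclotomicLevelsRat 3 (Literature.NumberTheory.EllipticCurves.Kato2004.EulerSystemValues.badPlaces c d A N)).level k r.1)) (x : ∀ (k : ℕ) (r : (Literature.NumberTheory.GaloisRepresentations.cyclotomicLevelsRat 3 (Literature.NumberTheory.EllipticCurves.Kato2004.EulerSystemValues.badPlaces c d A N)).Ideals), CyclotomicField (Literature.NumberTheory.EllipticCurves.Kato2004.EulerSystemValues.cycLevel 3 k r.1) ℚ), Literature.NumberTheory.EllipticCurves.Kato2004.ZetaBody W 3 f ι κ' Λ' c d a A z x → ∀ (y : I.H), (∀ n : ℕ, I.proj n y = Literature.NumberTheory.EllipticCurves.Kato2004.levelToLayer W 3 hκ h32 (Literature.NumberTheory.EllipticCurves.Kato2004.EulerSystemValues.badPlaces c d A N) n (z (n + 1) (Literature.NumberTheory.GaloisRepresentations.cyclotomicLevelsRat 3 (Literature.NumberTheory.EllipticCurves.Kato2004.EulerSystemValues.badPlaces c d A N)).idealOne)) → y ≠ 0 →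 ∃ (s : I.H) (a : Literature.NumberTheory.EllipticCurves.IwasawaAlgebra 3), Literature.NumberTheory.EllipticCurves.Kato2004.IsEulerSystemClass W 3 κ γ I s ∧ s ∉ Literature.NumberTheory.EllipticCurves.IwasawaAlgebra.augIdealP 3 • (⊤ : Submodule (Literature.NumberTheory.EllipticCurves.IwasawaAlgebra 3) I.H) ∧ a • s = y) :
    Summit.BirchSwinnertonDyer.BirchSwinnertonDyer.Theses.KatoDescentPotSupersingular.WildUpperNonsurjTower := by
  intro W _ _ _ hr hO6 hirr htower
  have hmodL : hasEntireLFunction_rat := hasEntireLFunction_rat_of_exists_isNewformOf hIn.1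
  have h32 : (3 : ℕ) ≠ 2 := by decide
  refine UniversalToricDescentWaldspurgerFlat.missingUpperBoundAt_rankZero_of_irreducible_of_fineSelmerDual_fg 3 h32 hKatoA
    hGZK hmodL W hr hO6.addv.2.1 hO6.padicValRat_j_nonneg hirr ?_
  intro κ hκ
  refine MuCoreIrr.exists_fineSelmerDualData_moduleFinite_three_of_irr_of_eulerClass W hirr κ hκ ?_
  intro γ I hγ
  letI : ContinuousSMul ℤ_[3] (W.tateModule 3) := TateModule.continuousSMul_padicInt
  haveI : Module.Free ℤ_[3] (W.tateModule 3) := W.module_free_tateModule_holds 3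
  haveI : Module.Finite ℤ_[3] (W.tateModule 3) := W.module_finite_tateModule_holds 3
  haveI : NeZero (W.conductorNorm ℤ) := ⟨W.conductorNorm_pos_holds.ne'⟩
  -- modularity: the newform of `W`
  obtain ⟨f, hf⟩ := hIn.1 W
  -- Kato's zeta Euler system with values for an admissible guarded datum
  set ι : (m : ℕ) → (CyclotomicField m ℚ →+* ℂ) :=
    fun m ↦ Classical.choice (inferInstance : Nonempty (CyclotomicField m ℚ →+* ℂ)) with hι
  obtain ⟨κ', hκ'0, Λ', hfam⟩ := hIn.2 W 3 hirr f hf ι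
  obtain ⟨c, d, a, A, d', hA, hc, hd, hcd, hdd', hR⟩ := valueGuard_satisfiable f hf.1 hf.coeffField_eq_bot 3
  obtain ⟨z, x, hbody⟩ := hfam c d a A hA hc hd
  have hne := two_mul_natAbs_ne_zero_of_guards 3 hA (NeZero.ne (W.conductorNorm ℤ)) hc hd
  -- the unique Λ-adic lift, a genuine Euler-system class, non-zero since `L(W,1) ≠ 0`
  obtain ⟨y, _hyES, hy⟩ := exists_isEulerSystemClass_of_zetaBody W 3 hκ h32 I f ι κ' Λ' c d a A z x hbody hne
  have hL1 : W.entireLFunction 1 ≠ 0 := (W.analyticRank_eq_zero_iff_holds hf.hasEntireLFunction).mp hr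
  have hy0 : y ≠ 0 := lift_ne_zero_of_bottom_ne_zero W 3 hκ I h32 (badPlaces c d A (W.conductorNorm ℤ)) hbody.1
    (zetaBody_bottom_ne_zero hbody hf hκ'0 hL1 hA d' hcd hdd' hR) hy
  -- the zeta statement on this U₀-ns row
  obtain ⟨s, _a, hsES, hs, _hsy⟩ := hZns W hr hO6 hirr htower h32 κ hκ γ I hγ f hf ι κ' Λ' c d a A hA hc hd z x hbody y hy hy0
  exact ⟨s, hsES, hs⟩

/-- **The U₀ parent `WildUpperDefectRankZero` (item 19197; type = the route decl verbatim) on the FINE road**: on an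
irreducible tower-SURJECTIVE rank-`0` O6 row A161″ + GZK + modularity (the held `KatoTamagawaExactInputs` 19191) bound `ord₃ #Ш`
outright (route-free `X4RankZero.missingUpperBoundAt_of_katoTam`, as in kmc's p413281); on an irreducible NON-surjective row the
node theorem above; on a reducible row the U₀-red node `WildUpperReducibleDefect` (19190, derived) — binders: A161-fine (19422),
GZK (19273), zeta-body inputs (24326), the Λ-MULTIPLE zeta statement on all U₀-ns rows, 19190, 19191.  Composition inlined
(no import of a route-importing Theorems module).  CONDITIONAL; item 19197 is NOT closed by this theorem.
[cite: Kato2004Asterisque, Thm. 14.5 (3) (p. 236), Prop. 14.16 (2) (p. 244)] [cite: GreenbergLNM1716, §4 Prop. 4.13]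
[cite: CoatesSujatha2005, Conjecture A] -/
theorem wildUpperDefectRankZero_of_fineReading_of_katoZetaMultiple
    (hKatoA : rankZero_padicValNat_sha_add_padicValNat_tamagawa_le_of_additive_potGood_of_irreducible_of_fineSelmerDual_fg)
    (hGZK : rank_eq_analyticRank_of_analyticRank_le_one)
    (hIn : (exists_isNewformOf : Prop) ∧ (exists_eulerSystem_expStar_values : Prop))
    (hZns : ∀ (W : WeierstrassCurve ℚ) [W.IsElliptic] [W.IsGloballyMinimal] [Fact (3 : ℕ).Prime], W.analyticRank = 0 → Summit.BirchSwinnertonDyer.Rank1Residual.Additive.ClassO6 W 3 → W.HasIrreducibleModPGaloisRep 3 → ¬ (∀ n : ℕ, W.HasSurjectiveModNGaloisRep (3 ^ n : ℕ)) → ∀ (h32 : (3 : ℕ) ≠ 2) (κ : Literature.NumberTheory.EllipticCurves.ZpExtension ℚ 3) (hκ : κ.IsCyclotomic) [ContinuousSMul ℤ_[3] (W.tateModule 3)] [Module.Free ℤ_[3] (W.tateModule 3)] [Module.Finite ℤ_[3] (W.tateModule 3)] (γ : Field.absoluteGaloisGroup ℚ) (I : Literature.NumberTheory.EllipticCurves.Kato2004.IwasawaH1Data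 W 3 κ γ), κ.IsTopGenerator γ → ∀ {N : ℕ} [NeZero N] (f : CuspForm (CongruenceSubgroup.Gamma0 N) 2), Literature.NumberTheory.EllipticCurves.ModularForms.IsNewformOf W f → ∀ (ι : (m : ℕ) → (CyclotomicField m ℚ →+* ℂ)) (κ' : ℝ) (Λ' : ∀ (k : ℕ) (r : Finset (IsDedekindDomain.HeightOneSpectrum (NumberField.RingOfIntegers ℚ))), Literature.NumberTheory.GaloisRepresentations.H1 (Literature.NumberTheory.EllipticCurves.Kato2004.EulerSystemValues.tateRep W 3) (Literature.NumberTheory.EllipticCurves.Kato2004.EulerSystemValues.cycSubgroup 3 k r) →ₗ[ℤ_[3]] TensorProduct ℚ ℚ_[3] (CyclotomicField (Literature.NumberTheory.EllipticCurves.Kato2004.EulerSystemValues.cycLevel 3 k r) ℚ)) (c d a : ℤ) (A : ℕ), 0 < A → Int.gcd c (6 * 3 * A) = 1 → Int.gcd d (6 * 3 * N) = 1 → ∀ (z : ∀ (k : ℕ) (r : (Literature.NumberTheory.GaloisRepresentations.cyclotomicLevelsRat 3 (Literature.NumberTheory.EllipticCurves.Kato2004.EulerSystemValues.badPlaces c d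 A N)).Ideals), Literature.NumberTheory.GaloisRepresentations.H1 (Literature.NumberTheory.EllipticCurves.Kato2004.EulerSystemValues.tateRep W 3) ((Literature.NumberTheory.GaloisRepresentations.cyclotomicLevelsRat 3 (Literature.NumberTheory.EllipticCurves.Kato2004.EulerSystemValues.badPlaces c d A N)).level k r.1)) (x : ∀ (k : ℕ) (r : (Literature.NumberTheory.GaloisRepresentations.cyclotomicLevelsRat 3 (Literature.NumberTheory.EllipticCurves.Kato2004.EulerSystemValues.badPlaces c d A N)).Ideals), CyclotomicField (Literature.NumberTheory.EllipticCurves.Kato2004.EulerSystemValues.cycLevel 3 k r.1) ℚ), Literature.NumberTheory.EllipticCurves.Kato2004.ZetaBody W 3 f ι κ' Λ' c d a A z x → ∀ (y : I.H), (∀ n : ℕ, I.proj n y = Literature.NumberTheory.EllipticCurves.Kato2004.levelToLayer W 3 hκ h32 (Literature.NumberTheory.EllipticCurves.Kato2004.EulerSystemValues.badPlaces c d A N) n (z (n + 1) (Literature.NumberTheory.GaloisRepresentations.cyclotomicLevelsRat 3 (Literature.NumberTheory.EllipticCurves.Kato2004.EulerSystemValues.badPlaces c d A N)).idealOne)) →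 y ≠ 0 → ∃ (s : I.H) (a : Literature.NumberTheory.EllipticCurves.IwasawaAlgebra 3), Literature.NumberTheory.EllipticCurves.Kato2004.IsEulerSystemClass W 3 κ γ I s ∧ s ∉ Literature.NumberTheory.EllipticCurves.IwasawaAlgebra.augIdealP 3 • (⊤ : Submodule (Literature.NumberTheory.EllipticCurves.IwasawaAlgebra 3) I.H) ∧ a • s = y)
    (h₄b : Summit.BirchSwinnertonDyer.BirchSwinnertonDyer.Theses.KatoDescentPotSupersingular.WildUpperReducibleDefect)
    (hK : Summit.BirchSwinnertonDyer.BirchSwinnertonDyer.Theses.KatoDescentPotSupersingular.KatoTamagawaExactInputs) :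
    Summit.BirchSwinnertonDyer.BirchSwinnertonDyer.Theses.KatoDescentPotSupersingular.WildUpperDefectRankZero := by
  intro W _ _ _ hr hO hcov
  by_cases hI : W.HasIrreducibleModPGaloisRep 3
  · by_cases hsurj : ∀ n : ℕ, W.HasSurjectiveModNGaloisRep (3 ^ n : ℕ)
    · -- irreducible, tower onto: A161″ + GZK + modularity (route-free X4 node)
      exact X4RankZero.missingUpperBoundAt_of_katoTam W 3 hK.1 hK.2.1 hK.2.2 hr ⟨hO.1, hO.2.1, hI⟩
        hO.padicValRat_j_nonneg hsurj
    · -- irreducible, tower not onto: the fine road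
      exact wildUpperNonsurjTower_of_fineReading_of_katoZetaMultiple hKatoA hGZK hIn hZns W hr hO hI hsurj
  · -- reducible: the U₀-red node
    exact h₄b W hr hO hI (fun h ↦ hcov (Or.inr ⟨hI, h⟩))

end Summit.BirchSwinnertonDyer.BirchSwinnertonDyer.Theorems.WildUpperFineRoadKatoZeta

end
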